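/-
Copyright: the b2b-balaban T⁴-continuum CRUX team, row NE7b OWNER lineage `t4-ne7b-p1` (gen 141). Project licence.
-/
import Summits.QuantumFields.BalabanUV.T4Continuum.Spine.NE7b.SupWhitenedMixedThirdCumulantRaw
import Summits.QuantumFields.BalabanUV.T4Continuum.Spine.NE7b.SupWhitenedThirdCumulantEntry

/-!
# THE MIXED THIRD-CUMULANT ENTRY `κ₃(U″e_xe_y, U′e_z, U′e_t)` HAS TREE DECAY, GENERAL `Γ = AAᵀ`, ANY ADMISSIBLE `D` (SCOPING (d13)(2): the
# three-point pieces of `∂⁴W`, second file).  From (507)'s three distinguished forms, (466)'s decay of `B` for the pairs `(g^{xy}, b^v)`,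
# `(b^v, g^{xy})`, `(b^v, b^{v′})` — the Hessian vector `g^{xy}_w = Σ_u|A_{uw}|K3_{xyu}` weighted at the site `x` with the SAME profile letters
# `αθ, βθ` as the gradient vectors (a sampler weight `θ ≥ 0`, a compatible cross weight `σ`, a symmetric submultiplicative site weight `ρ ≥ 1`
# with `ρ⁸ ≤ σσ`) — and (463)'s tree lemma at the triangle `x, z, t`:
#   `|E_ν(G_{xy} − EG_{xy})(F_z − EF_z)(F_t − EF_t)| ≤ 4√(MK)∕(ρ_{xz}ρ_{xt})`,  `M = 5(κ₂⁴+κ₃⁴)γ_op²∕(1−λγ_op)²`, `K = αθ·dθ·(βθ·dθ′)∕(1−lamA)`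
# — NO dependence on the background; also in tilted form under `N(0,AAᵀ)` by the bridges (row NE7b, node U5c; (463), (466), (475), (478),
# (507) BY NAME; [folklore])

Cell `pub-balaban`, sub-cell `t4`, spine estimate NE7b (`T4WeightBudget.RelWeightBound`; the cell's OWN estimate — NOT PRINTED in
[Bałaban 1983–89], NOT PROVED).  Crux-route work under `Spine/NE7b/` by the row OWNER (`t4-ne7b-p1` gen 141, file (508)) under FREEZE
(0)'s crux-prover clause; NOTHING of Bałaban's is named as a Lean object, valued or asserted; no `T4Continuum/Support` leaf typed; no
`def`, no notation; zero `sorry`.  Imports (BY NAME): the OWNER's (507) `…SupWhitenedMixedThirdCumulantRaw` (`whitened_mixed_third_cumulant_hess_raw`,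
`whitened_mixed_third_cumulant_grad_raw`), (478) `…SupWhitenedThirdCumulantEntry` (for its imports: (475) `whitened_mean_bridge`, (466)
`cross_bilinear_decay`, (463) `distinguished_bound`, `tree_bound`, (457) `whitened_tilted_eq_gauss`, `whitened_integral_eq`, (456)
`whitened_obs_nonneg`, `whitened_cross_nonneg`, `whitened_J_rowsum_le`).

WHAT IS PROVED ([folklore]; any admissible `D` with weighted letters):
* §1 **`whitened_mixed_third_cumulant_entry_raw`** (the display, whitened Lebesgue tilted format).
* §2 the bridges `whitened_hess_mean_bridge`, `whitened_mixed_triple_bridge`, THE END **`whitened_mixed_third_cumulant_entry`** (tilted form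
  under `N(0,AAᵀ)`, centring constants `g₀ = Z⁻¹∫e^{−U}U″e_xe_y`, `a_v = Z⁻¹∫e^{−U}U′e_v`); §3 toy.

HONEST (what this is NOT).  One mixed entry (the placement `x ∈` Hessian pair; the placement `x` = a gradient slot, `κ₃(U′e_x, U″e_ye_z, U′e_t)`,
is the same two files with the Hessian vector weighted at `y` — successor); the row letter over `(y,z,t)` (finite support in `y`, tree sum in
`z,t`) and the Hessian vector's profile letters from the geometry ((476)-type) are successor files; the cumulant FORM of `∂⁴W` is NOT typed.
Scalar skeleton ((A3), NC-NE7b-α UNRULED); nothing of Bałaban's asserted.  BY-NAME EFFECT ON THE WALL: NONE.  NE7b NOT PRINTED ∕ NOT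
PROVED; spine PROVED 0∕9; rung (B)+1 — the programme's measures remain FINITE-torus statements; NOT the mass gap, NOT Clay.  HONEST
DEPENDENCY: continuum YM on T⁴ ⇐ BetaPertH ∧ nine spine estimates (0∕9 proved); BetaPertH ⇐ (D1) ∧ (D4) ∧ CAP+tail; G-an2-4 gates asym,
D1 and NE2∕3∕4.
-/

set_option autoImplicit false
set_option maxSynthPendingDepth 2

noncomputable section

namespace Summit.QuantumFields.BalabanUV.T4Continuum.NE7b.SupWhitenedMixedThirdCumulantEntry

open MeasureTheory ProbabilityTheory Real Set Function Finset Matrix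
open scoped BigOperators
open Literature.Probability.Distributions (matrixCLM)
open SupWhitenedMixedThirdCumulantRaw (whitened_mixed_third_cumulant_hess_raw whitened_mixed_third_cumulant_grad_raw)
open SupCrossWeightedCovarianceDecay (cross_bilinear_decay)
open SupThirdCumulantTreeDecay (distinguished_bound tree_bound)
open SupWhitenedFirstOrderLetters (whitened_cross_nonneg whitened_obs_nonneg whitened_J_rowsum_le)
open SupWhitenedThirdKernelLetter (whitened_mean_bridge)
open SupWhitenedCovarianceKernelLetter (whitened_tilted_eq_gauss whitened_integral_eq)
open SupWhitenedMomentLetters (op_letter_nonneg)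

variable {ι κ : Type} [Fintype ι] [DecidableEq ι] [Fintype κ] [DecidableEq κ]

variable {U : EuclideanSpace ℝ ι → ℝ} {U' : EuclideanSpace ℝ ι → EuclideanSpace ℝ ι →L[ℝ] ℝ}
  {U'' : EuclideanSpace ℝ ι → EuclideanSpace ℝ ι →L[ℝ] EuclideanSpace ℝ ι →L[ℝ] ℝ}
  {U₃ : EuclideanSpace ℝ ι → EuclideanSpace ℝ ι →L[ℝ] EuclideanSpace ℝ ι →L[ℝ] EuclideanSpace ℝ ι →L[ℝ] ℝ} {Hk : ι → ι → ℝ} {K3 : ι → ι → ι → ℝ}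
  {A : Matrix ι κ ℝ} {D : κ → κ → ℝ} {γop κ₀ κ₁ κ₂ κ₃ a τ δ θp lam lamA αr αc hr γ dθ dθ' αθ βθ : ℝ} {θ : κ → κ → ℝ} {σ : ι → κ → ℝ}
  {ρ : ι → ι → ℝ}

/-! ## §1. The raw entry (whitened Lebesgue tilted format) -/

/-- **THE MIXED THIRD-CUMULANT ENTRY, GENERAL `Γ = AAᵀ`, ANY ADMISSIBLE `D`**:
`|E_ν(G_{xy} − EG_{xy})(F_z − EF_z)(F_t − EF_t)| ≤ 4√(MK)∕(ρ_{xz}ρ_{xt})`. [folklore] -/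
theorem whitened_mixed_third_cumulant_entry_raw [Nonempty κ] (hΓop : (γop • (1 : Matrix ι ι ℝ) - A * Aᵀ).PosSemidef) (Y : Finset ι)
    (hUd : ∀ φ : EuclideanSpace ℝ ι, HasFDerivAt U (U' φ) φ) (hU'd : ∀ φ : EuclideanSpace ℝ ι, HasFDerivAt U' (U'' φ) φ)
    (hU''d : ∀ φ : EuclideanSpace ℝ ι, HasFDerivAt U'' (U₃ φ) φ) (hU₃c : Continuous U₃) (hκ₀ : 0 ≤ κ₀) (hκ₁ : 0 ≤ κ₁) (ha : 0 ≤ a) (hτ : 0 < τ)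
    (hδ : 0 < δ) (hθ0 : 0 < θp) (hθ1 : θp < 1) (hκθ : (2 * κ₀ * (1 + τ) + 4 * δ) * γop ≤ θp) (hκθw : 2 * κ₀ * (1 + τ) * γop + 4 * δ ≤ θp)
    (hstab : ∀ φ : EuclideanSpace ℝ ι, -(κ₀ * ∑ x ∈ Y, φ x ^ 2) ≤ U φ)
    (hU'b : ∀ φ : EuclideanSpace ℝ ι, ‖U' φ‖ ≤ κ₁ * (a + ∑ x ∈ Y, φ x ^ 2)) (hU''b : ∀ φ : EuclideanSpace ℝ ι, ‖U'' φ‖ ≤ κ₂)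
    (hU₃b : ∀ φ : EuclideanSpace ℝ ι, ‖U₃ φ‖ ≤ κ₃) (hlam : 0 ≤ lam)
    (hUsec : ∀ s : ℝ, 0 ≤ s → s ≤ 1 → ∀ a b : EuclideanSpace ℝ ι,
      U ((1 - s) • a + s • b) - lam / 2 * (s * (1 - s)) * ∑ i, (a i - b i) ^ 2 ≤ (1 - s) * U a + s * U b)
    (hρg : lam * γop < 1)
    (hHk : ∀ (φ : EuclideanSpace ℝ ι) (x z : ι), |U'' φ (EuclideanSpace.single z (1 : ℝ)) (EuclideanSpace.single x (1 : ℝ))| ≤ Hk x z)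
    (hHk0 : ∀ v u, 0 ≤ Hk v u)
    (hK3 : ∀ (φ : EuclideanSpace ℝ ι) (u x y : ι),
      |U₃ φ (EuclideanSpace.single u (1 : ℝ)) (EuclideanSpace.single x (1 : ℝ)) (EuclideanSpace.single y (1 : ℝ))| ≤ K3 x y u)
    (hK30 : ∀ x y u, 0 ≤ K3 x y u) (ψ : EuclideanSpace ℝ ι)
    (hαr : ∀ u, ∑ w, |A u w| ≤ αr) (hαc : ∀ w, ∑ u, |A u w| ≤ αc) (hhr : ∀ v, ∑ u, Hk v u ≤ hr)
    (hlamA : ∀ x : κ, ∑ u, ∑ v, |A u x| * |A v x| * Hk v u ≤ lamA) (hlamA1 : lamA < 1) (hγ : αc * hr * αr / (1 - lamA) ≤ γ) (hγ1 : γ < 1)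
    -- the admissible `D` and its weighted letters
    (hD : ∀ x y, 0 ≤ D x y)
    (hDC : ∀ x y, (if x = y then (1 : ℝ) else 0) + ∑ z, D x z * ((if y = z then 0 else ∑ u, ∑ v, |A u y| * |A v z| * Hk v u) / (1 - lamA)) ≤ D x y)
    (hθnn : ∀ z w, 0 ≤ θ z w) (hDr : ∀ z, ∑ w, D z w * θ z w ≤ dθ) (hdθ : 0 ≤ dθ) (hDc : ∀ w, ∑ z, D z w * θ z w ≤ dθ') (hdθ' : 0 ≤ dθ')
    -- the weights and the weighted profiles (gradient vectors `b^v` at their sites, the Hessian vector `g^{xy}` at the site `x`)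
    (hσ0 : ∀ x w, 0 ≤ σ x w) (hσθ : ∀ x z w, σ x w ≤ σ x z * θ z w)
    (hρ1 : ∀ x y, 1 ≤ ρ x y) (hρsymm : ∀ x y, ρ x y = ρ y x) (hρmul : ∀ x y z, ρ x z ≤ ρ x y * ρ y z) (hρσ : ∀ x y w, ρ x y ^ 8 ≤ σ x w * σ y w)
    (haσ : ∀ v : ι, ∑ w, (∑ u, |A u w| * Hk v u) * σ v w ≤ αθ) (hβ : 0 ≤ βθ) (haσ' : ∀ (v : ι) (w : κ), (∑ u, |A u w| * Hk v u) * σ v w ≤ βθ)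
    (x y : ι) (hgσ : ∑ w, (∑ u, |A u w| * K3 x y u) * σ x w ≤ αθ) (hgσ' : ∀ w : κ, (∑ u, |A u w| * K3 x y u) * σ x w ≤ βθ) (z t : ι) :
    |∫ w, (U'' (matrixCLM A (WithLp.toLp 2 w) + ψ) (EuclideanSpace.single x (1 : ℝ)) (EuclideanSpace.single y (1 : ℝ)) -
            ∫ w', U'' (matrixCLM A (WithLp.toLp 2 w') + ψ) (EuclideanSpace.single x (1 : ℝ)) (EuclideanSpace.single y (1 : ℝ))
              ∂((volume : Measure (κ → ℝ)).tilted fun z => -(1 / 2 * (z ⬝ᵥ z) + U (matrixCLM A (WithLp.toLp 2 z) + ψ)))) *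
          (U' (matrixCLM A (WithLp.toLp 2 w) + ψ) (EuclideanSpace.single z (1 : ℝ)) -
            ∫ w', U' (matrixCLM A (WithLp.toLp 2 w') + ψ) (EuclideanSpace.single z (1 : ℝ))
              ∂((volume : Measure (κ → ℝ)).tilted fun z => -(1 / 2 * (z ⬝ᵥ z) + U (matrixCLM A (WithLp.toLp 2 z) + ψ)))) *
          (U' (matrixCLM A (WithLp.toLp 2 w) + ψ) (EuclideanSpace.single t (1 : ℝ)) -
            ∫ w', U' (matrixCLM A (WithLp.toLp 2 w') + ψ) (EuclideanSpace.single t (1 : ℝ))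
              ∂((volume : Measure (κ → ℝ)).tilted fun z => -(1 / 2 * (z ⬝ᵥ z) + U (matrixCLM A (WithLp.toLp 2 z) + ψ))))
        ∂((volume : Measure (κ → ℝ)).tilted fun z => -(1 / 2 * (z ⬝ᵥ z) + U (matrixCLM A (WithLp.toLp 2 z) + ψ)))| ≤
      4 * Real.sqrt ((5 * ((κ₂ ^ 4 + κ₃ ^ 4) * γop ^ 2) / (1 - lam * γop) ^ 2) * (αθ * dθ * (βθ * dθ') / (1 - lamA))) / (ρ x z * ρ x t) := by
  obtain ⟨w₀⟩ := ‹Nonempty κ›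
  haveI : Nonempty ι := ⟨x⟩
  have hl1 : 0 < 1 - lamA := by linarith
  have hγop := op_letter_nonneg hΓop
  -- Dobrushin's plain row condition from the letters
  have hrow : ∀ x : κ, ∑ w, (if w = x then 0 else ∑ u, ∑ v, |A u w| * |A v x| * Hk v u) / (1 - lamA) ≤ γ := fun x => by
    rw [← Finset.sum_div]
    refine le_trans (div_le_div_of_nonneg_right ?_ hl1.le) hγ
    refine le_trans (Finset.sum_le_sum fun w _ => ?_) (whitened_J_rowsum_le hHk0 hαr hαc hhr x)
    split_ifs
    · exact le_rfl
    · linarith [abs_nonneg ((1 : Matrix κ κ ℝ) x w)]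
  have hγ0 : 0 ≤ γ := by
    refine le_trans (Finset.sum_nonneg fun w _ => div_nonneg ?_ hl1.le) (hrow w₀)
    split_ifs
    · exact le_rfl
    · exact whitened_cross_nonneg hHk0 A w₀ w
  -- the constants
  have hαθ : 0 ≤ αθ := le_trans (Finset.sum_nonneg fun w _ => mul_nonneg (whitened_obs_nonneg hHk0 A x w) (hσ0 x w)) (haσ x)
  have hK : 0 ≤ (αθ * dθ * (βθ * dθ') / (1 - lamA)) := by positivity
  have hM : 0 ≤ (5 * ((κ₂ ^ 4 + κ₃ ^ 4) * γop ^ 2) / (1 - lam * γop) ^ 2) := by positivity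
  have hgnn : ∀ w : κ, 0 ≤ ∑ u, |A u w| * K3 x y u := fun w => Finset.sum_nonneg fun u _ => mul_nonneg (abs_nonneg _) (hK30 x y u)
  -- Step 1: the decay of `B` for the three kinds of pairs ((466))
  have hBgb : ∀ v : ι, ∑ w, (∑ z', D z' w * ∑ u, |A u z'| * K3 x y u) * (∑ z', D z' w * ∑ u, |A u z'| * Hk v u) / (1 - lamA) ≤
      (αθ * dθ * (βθ * dθ') / (1 - lamA)) / ρ x v ^ 8 := fun v => by
    have h := cross_bilinear_decay (D := D) (θ := θ) (σ := σ) (ρ := fun x y => ρ x y ^ 8) (c := fun _ => 1 - lamA)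
      (a := fun w => ∑ u, |A u w| * K3 x y u) (b := fun w => ∑ u, |A u w| * Hk v u) hD hθnn hσ0 hσθ (fun x y w => hρσ x y w)
      (fun x y => one_le_pow₀ (hρ1 x y)) hDr hdθ hDc hdθ' hl1 (fun _ => le_rfl) hgnn (fun w => whitened_obs_nonneg hHk0 A v w) x v hgσ hβ (haσ' v)
    rw [div_mul_eq_div_div] at h
    exact h
  have hBbg : ∀ v : ι, ∑ w, (∑ z', D z' w * ∑ u, |A u z'| * Hk v u) * (∑ z', D z' w * ∑ u, |A u z'| * K3 x y u) / (1 - lamA) ≤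
      (αθ * dθ * (βθ * dθ') / (1 - lamA)) / ρ v x ^ 8 := fun v => by
    have h := cross_bilinear_decay (D := D) (θ := θ) (σ := σ) (ρ := fun x y => ρ x y ^ 8) (c := fun _ => 1 - lamA)
      (a := fun w => ∑ u, |A u w| * Hk v u) (b := fun w => ∑ u, |A u w| * K3 x y u) hD hθnn hσ0 hσθ (fun x y w => hρσ x y w)
      (fun x y => one_le_pow₀ (hρ1 x y)) hDr hdθ hDc hdθ' hl1 (fun _ => le_rfl) (fun w => whitened_obs_nonneg hHk0 A v w) hgnn v x (haσ v) hβ hgσ'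
    rw [div_mul_eq_div_div] at h
    exact h
  have hBbb : ∀ v v' : ι, ∑ w, (∑ z', D z' w * ∑ u, |A u z'| * Hk v u) * (∑ z', D z' w * ∑ u, |A u z'| * Hk v' u) / (1 - lamA) ≤
      (αθ * dθ * (βθ * dθ') / (1 - lamA)) / ρ v v' ^ 8 := fun v v' => by
    have h := cross_bilinear_decay (D := D) (θ := θ) (σ := σ) (ρ := fun x y => ρ x y ^ 8) (c := fun _ => 1 - lamA)
      (a := fun w => ∑ u, |A u w| * Hk v u) (b := fun w => ∑ u, |A u w| * Hk v' u) hD hθnn hσ0 hσθ (fun x y w => hρσ x y w)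
      (fun x y => one_le_pow₀ (hρ1 x y)) hDr hdθ hDc hdθ' hl1 (fun _ => le_rfl) (fun w => whitened_obs_nonneg hHk0 A v w)
      (fun w => whitened_obs_nonneg hHk0 A v' w) v v' (haσ v) hβ (haσ' v')
    rw [div_mul_eq_div_div] at h
    exact h
  -- Step 2: (507)'s distinguished forms and the splits `Σ_w P(Q+R)/c = B + B`
  have hA := whitened_mixed_third_cumulant_hess_raw hΓop Y hUd hU'd hU''d hU₃c hκ₀ hκ₁ ha hτ hδ hθ0 hθ1 hκθ hκθw hstab hU'b hU''b hU₃b hlam hUsec hρg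
      hHk hHk0 hK3 ψ hlamA hlamA1 hrow hγ0 hγ1 hD hDC x y z t
  have hBz := whitened_mixed_third_cumulant_grad_raw hΓop Y hUd hU'd hU''d hU₃c hκ₀ hκ₁ ha hτ hδ hθ0 hθ1 hκθ hκθw hstab hU'b hU''b hU₃b hlam hUsec
      hρg hHk hHk0 hK3 ψ hlamA hlamA1 hrow hγ0 hγ1 hD hDC x y z t
  have hBt := whitened_mixed_third_cumulant_grad_raw hΓop Y hUd hU'd hU''d hU₃c hκ₀ hκ₁ ha hτ hδ hθ0 hθ1 hκθ hκθw hstab hU'b hU''b hU₃b hlam hUsec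
      hρg hHk hHk0 hK3 ψ hlamA hlamA1 hrow hγ0 hγ1 hD hDC x y t z
  have hsplit : ∀ P Q R : κ → ℝ, ∑ w, P w * (Q w + R w) / (1 - lamA) = ∑ w, P w * Q w / (1 - lamA) + ∑ w, P w * R w / (1 - lamA) :=
    fun P Q R => by
      rw [← Finset.sum_add_distrib]
      exact Finset.sum_congr rfl fun w _ => by ring
  have hreshape : ∀ (T S B₁ B₂ : ℝ), S = B₁ + B₂ → T ≤ 2 * Real.sqrt (2 * S * (5 * ((κ₂ ^ 4 + κ₃ ^ 4) * γop ^ 2) / (1 - lam * γop) ^ 2)) → T ≤ 2 *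
      Real.sqrt (2 * (5 * ((κ₂ ^ 4 + κ₃ ^ 4) * γop ^ 2) / (1 - lam * γop) ^ 2) * (B₁ + B₂)) :=
    fun T S B₁ B₂ hS h => by
      rw [hS, show 2 * (B₁ + B₂) * (5 * ((κ₂ ^ 4 + κ₃ ^ 4) * γop ^ 2) / (1 - lam * γop) ^ 2) = 2 * (5 * ((κ₂ ^ 4 + κ₃ ^ 4) * γop ^ 2) / (1 - lam *
          γop) ^ 2) * (B₁ + B₂) from by ring] at h
      exact h
  -- Step 3: the distinguished bounds ((463) `distinguished_bound`)
  have dA := distinguished_bound hM hK (hρ1 x z) (hρ1 x t) (hBgb z) (hBgb t)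
    (hreshape _ _ _ _ (hsplit (fun w => (∑ z', D z' w * ∑ u, |A u z'| * K3 x y u)) (fun w => (∑ z', D z' w * ∑ u, |A u z'| * Hk z u)) (fun w => (∑
        z', D z' w * ∑ u, |A u z'| * Hk t u))) hA)
  have dBz := distinguished_bound hM hK (hρ1 z x) (hρ1 z t) (hBbg z) (hBbb z t)
    (hreshape _ _ _ _ (hsplit (fun w => (∑ z', D z' w * ∑ u, |A u z'| * Hk z u)) (fun w => (∑ z', D z' w * ∑ u, |A u z'| * K3 x y u)) (fun w => (∑
        z', D z' w * ∑ u, |A u z'| * Hk t u))) hBz)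
  have dBt := distinguished_bound hM hK (hρ1 t x) (hρ1 t z) (hBbg t) (hBbb t z)
    (hreshape _ _ _ _ (hsplit (fun w => (∑ z', D z' w * ∑ u, |A u z'| * Hk t u)) (fun w => (∑ z', D z' w * ∑ u, |A u z'| * K3 x y u)) (fun w => (∑
        z', D z' w * ∑ u, |A u z'| * Hk z u))) hBt)
  -- Step 4: the tree bound at the triangle `x, z, t` (`p = ρ_xz`, `q = ρ_xt`, `r = ρ_zt`; integrands commuted)
  have hC : 0 ≤ 4 * Real.sqrt ((5 * ((κ₂ ^ 4 + κ₃ ^ 4) * γop ^ 2) / (1 - lam * γop) ^ 2) * (αθ * dθ * (βθ * dθ') / (1 - lamA))) := by positivity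
  have hqpr : ρ x t ≤ ρ x z * ρ z t := hρmul x z t
  have hpqr : ρ x z ≤ ρ x t * ρ t z := hρmul x t z
  rw [hρsymm t z] at hpqr
  refine tree_bound hC (hρ1 x z) (hρ1 x t) (hρ1 z t) hqpr hpqr dA ?_ ?_
  · -- `z` distinguished: `ρ z x = ρ x z`; commute the first two factors
    rw [hρsymm z x] at dBz
    refine le_trans (le_of_eq ?_) dBz
    congr 1
    exact integral_congr_ae (ae_of_all _ fun w => by ring)
  · -- `t` distinguished: `ρ t x = ρ x t`, `ρ t z = ρ z t`
    rw [hρsymm t x, hρsymm t z] at dBt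
    refine le_trans (le_of_eq ?_) dBt
    congr 1
    exact integral_congr_ae (ae_of_all _ fun w => by ring)

/-! ## §2. The bridges and THE END under `N(0, AAᵀ)` -/

/-- **The Hessian mean bridge**: `E_ν G_{xy} = Z⁻¹∫e^{−U}U″(ω+ψ)[e_x,e_y] dN(0,AAᵀ)`. [folklore] -/
theorem whitened_hess_mean_bridge (hUc : Continuous U) (hU''c : Continuous U'') (A : Matrix ι κ ℝ) (ψ : EuclideanSpace ℝ ι) (x y : ι) :
    ∫ w, U'' (matrixCLM A (WithLp.toLp 2 w) + ψ) (EuclideanSpace.single x (1 : ℝ)) (EuclideanSpace.single y (1 : ℝ)) ∂((volume : Measure (κ →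
        ℝ)).tilted fun z => -(1 / 2 * (z ⬝ᵥ z) + U (matrixCLM A (WithLp.toLp 2 z) + ψ))) =
      ((∫ ω : EuclideanSpace ℝ ι, exp (-U (ω + ψ)) ∂(multivariateGaussian 0 (A * Aᵀ)))⁻¹ *
            (∫ ω : EuclideanSpace ℝ ι, exp (-U (ω + ψ)) * U'' (ω + ψ) (EuclideanSpace.single x (1 : ℝ)) (EuclideanSpace.single y (1 : ℝ))
                ∂(multivariateGaussian 0 (A * Aᵀ)))) := by
  have hsh : Continuous fun ω : EuclideanSpace ℝ ι => ω + ψ := continuous_id.add continuous_const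
  have he : Continuous fun ω : EuclideanSpace ℝ ι => exp (-U (ω + ψ)) := continuous_exp.comp (hUc.comp hsh).neg
  have hg : Continuous fun ω : EuclideanSpace ℝ ι => U'' (ω + ψ) (EuclideanSpace.single x (1 : ℝ)) (EuclideanSpace.single y (1 : ℝ)) := ((hU''c.comp
      hsh).clm_apply continuous_const).clm_apply continuous_const
  have hm : AEStronglyMeasurable (fun ω : EuclideanSpace ℝ ι => exp (-U (ω + ψ)) * U'' (ω + ψ) (EuclideanSpace.single x (1 : ℝ))
      (EuclideanSpace.single y (1 : ℝ))) (multivariateGaussian 0 (A * Aᵀ)) :=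
    (he.mul hg).aestronglyMeasurable
  rw [whitened_tilted_eq_gauss A ψ]
  simp only [WithLp.toLp_ofLp]
  rw [whitened_integral_eq A he.aestronglyMeasurable, whitened_integral_eq A hm, div_eq_inv_mul]

/-- **The mixed triple bridge**: for any centring constants `c_g, c_k, c_l`,
`E_ν(G_{xy}−c_g)(F_k−c_k)(F_l−c_l) = Z⁻¹∫e^{−U}(U″e_xe_y−c_g)(U′k−c_k)(U′l−c_l) dN(0,AAᵀ)`. [folklore] -/
theorem whitened_mixed_triple_bridge (hUc : Continuous U) (hU'c : Continuous U') (hU''c : Continuous U'') (A : Matrix ι κ ℝ) (ψ : EuclideanSpace ℝ ι)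
    (x y : ι) (k l : EuclideanSpace ℝ ι) (cg ck cl : ℝ) :
    ∫ w, (U'' (matrixCLM A (WithLp.toLp 2 w) + ψ) (EuclideanSpace.single x (1 : ℝ)) (EuclideanSpace.single y (1 : ℝ)) - cg) * (U' (matrixCLM A
        (WithLp.toLp 2 w) + ψ) k - ck) *
        (U' (matrixCLM A (WithLp.toLp 2 w) + ψ) l - cl) ∂((volume : Measure (κ → ℝ)).tilted fun z => -(1 / 2 * (z ⬝ᵥ z) + U (matrixCLM A (WithLp.toLp
            2 z) + ψ))) =
      (∫ ω : EuclideanSpace ℝ ι, exp (-U (ω + ψ)) ∂(multivariateGaussian 0 (A * Aᵀ)))⁻¹ * (∫ ω : EuclideanSpace ℝ ι, exp (-U (ω + ψ)) *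
        ((U'' (ω + ψ) (EuclideanSpace.single x (1 : ℝ)) (EuclideanSpace.single y (1 : ℝ)) - cg) * (U' (ω + ψ) k - ck) * (U' (ω + ψ) l - cl))
            ∂(multivariateGaussian 0 (A * Aᵀ))) := by
  have hsh : Continuous fun ω : EuclideanSpace ℝ ι => ω + ψ := continuous_id.add continuous_const
  have he : Continuous fun ω : EuclideanSpace ℝ ι => exp (-U (ω + ψ)) := continuous_exp.comp (hUc.comp hsh).neg
  have hg : Continuous fun ω : EuclideanSpace ℝ ι => U'' (ω + ψ) (EuclideanSpace.single x (1 : ℝ)) (EuclideanSpace.single y (1 : ℝ)) := ((hU''c.comp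
      hsh).clm_apply continuous_const).clm_apply continuous_const
  have hf : ∀ v : EuclideanSpace ℝ ι, Continuous fun ω : EuclideanSpace ℝ ι => U' (ω + ψ) v := fun v => (hU'c.comp hsh).clm_apply continuous_const
  have hP : Continuous fun ω : EuclideanSpace ℝ ι => exp (-U (ω + ψ)) * ((U'' (ω + ψ) (EuclideanSpace.single x (1 : ℝ)) (EuclideanSpace.single y (1 :
      ℝ)) - cg) * (U' (ω + ψ) k - ck) * (U' (ω + ψ) l - cl)) :=
    he.mul (((hg.sub continuous_const).mul ((hf k).sub continuous_const)).mul ((hf l).sub continuous_const))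
  rw [whitened_tilted_eq_gauss A ψ]
  simp only [WithLp.toLp_ofLp]
  rw [whitened_integral_eq A he.aestronglyMeasurable, whitened_integral_eq A hP.aestronglyMeasurable, div_eq_inv_mul]

/-- **THE MIXED THIRD-CUMULANT ENTRY UNDER `N(0,AAᵀ)`**: with `g₀ = Z⁻¹∫e^{−U}U″e_xe_y`, `a_v = Z⁻¹∫e^{−U}U′e_v`,
`|Z⁻¹∫e^{−U}(U″e_xe_y − g₀)(U′e_z − a_z)(U′e_t − a_t) dN(0,AAᵀ)| ≤ 4√(MK)∕(ρ_{xz}ρ_{xt})`. [folklore] -/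
theorem whitened_mixed_third_cumulant_entry [Nonempty κ] (hΓop : (γop • (1 : Matrix ι ι ℝ) - A * Aᵀ).PosSemidef) (Y : Finset ι)
    (hUd : ∀ φ : EuclideanSpace ℝ ι, HasFDerivAt U (U' φ) φ) (hU'd : ∀ φ : EuclideanSpace ℝ ι, HasFDerivAt U' (U'' φ) φ)
    (hU''d : ∀ φ : EuclideanSpace ℝ ι, HasFDerivAt U'' (U₃ φ) φ) (hU₃c : Continuous U₃) (hκ₀ : 0 ≤ κ₀) (hκ₁ : 0 ≤ κ₁) (ha : 0 ≤ a) (hτ : 0 < τ)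
    (hδ : 0 < δ) (hθ0 : 0 < θp) (hθ1 : θp < 1) (hκθ : (2 * κ₀ * (1 + τ) + 4 * δ) * γop ≤ θp) (hκθw : 2 * κ₀ * (1 + τ) * γop + 4 * δ ≤ θp)
    (hstab : ∀ φ : EuclideanSpace ℝ ι, -(κ₀ * ∑ x ∈ Y, φ x ^ 2) ≤ U φ)
    (hU'b : ∀ φ : EuclideanSpace ℝ ι, ‖U' φ‖ ≤ κ₁ * (a + ∑ x ∈ Y, φ x ^ 2)) (hU''b : ∀ φ : EuclideanSpace ℝ ι, ‖U'' φ‖ ≤ κ₂)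
    (hU₃b : ∀ φ : EuclideanSpace ℝ ι, ‖U₃ φ‖ ≤ κ₃) (hlam : 0 ≤ lam)
    (hUsec : ∀ s : ℝ, 0 ≤ s → s ≤ 1 → ∀ a b : EuclideanSpace ℝ ι,
      U ((1 - s) • a + s • b) - lam / 2 * (s * (1 - s)) * ∑ i, (a i - b i) ^ 2 ≤ (1 - s) * U a + s * U b)
    (hρg : lam * γop < 1)
    (hHk : ∀ (φ : EuclideanSpace ℝ ι) (x z : ι), |U'' φ (EuclideanSpace.single z (1 : ℝ)) (EuclideanSpace.single x (1 : ℝ))| ≤ Hk x z)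
    (hHk0 : ∀ v u, 0 ≤ Hk v u)
    (hK3 : ∀ (φ : EuclideanSpace ℝ ι) (u x y : ι),
      |U₃ φ (EuclideanSpace.single u (1 : ℝ)) (EuclideanSpace.single x (1 : ℝ)) (EuclideanSpace.single y (1 : ℝ))| ≤ K3 x y u)
    (hK30 : ∀ x y u, 0 ≤ K3 x y u) (ψ : EuclideanSpace ℝ ι)
    (hαr : ∀ u, ∑ w, |A u w| ≤ αr) (hαc : ∀ w, ∑ u, |A u w| ≤ αc) (hhr : ∀ v, ∑ u, Hk v u ≤ hr)
    (hlamA : ∀ x : κ, ∑ u, ∑ v, |A u x| * |A v x| * Hk v u ≤ lamA) (hlamA1 : lamA < 1) (hγ : αc * hr * αr / (1 - lamA) ≤ γ) (hγ1 : γ < 1)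
    -- the admissible `D` and its weighted letters
    (hD : ∀ x y, 0 ≤ D x y)
    (hDC : ∀ x y, (if x = y then (1 : ℝ) else 0) + ∑ z, D x z * ((if y = z then 0 else ∑ u, ∑ v, |A u y| * |A v z| * Hk v u) / (1 - lamA)) ≤ D x y)
    (hθnn : ∀ z w, 0 ≤ θ z w) (hDr : ∀ z, ∑ w, D z w * θ z w ≤ dθ) (hdθ : 0 ≤ dθ) (hDc : ∀ w, ∑ z, D z w * θ z w ≤ dθ') (hdθ' : 0 ≤ dθ')
    -- the weights and the weighted profiles (gradient vectors `b^v` at their sites, the Hessian vector `g^{xy}` at the site `x`)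
    (hσ0 : ∀ x w, 0 ≤ σ x w) (hσθ : ∀ x z w, σ x w ≤ σ x z * θ z w)
    (hρ1 : ∀ x y, 1 ≤ ρ x y) (hρsymm : ∀ x y, ρ x y = ρ y x) (hρmul : ∀ x y z, ρ x z ≤ ρ x y * ρ y z) (hρσ : ∀ x y w, ρ x y ^ 8 ≤ σ x w * σ y w)
    (haσ : ∀ v : ι, ∑ w, (∑ u, |A u w| * Hk v u) * σ v w ≤ αθ) (hβ : 0 ≤ βθ) (haσ' : ∀ (v : ι) (w : κ), (∑ u, |A u w| * Hk v u) * σ v w ≤ βθ)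
    (x y : ι) (hgσ : ∑ w, (∑ u, |A u w| * K3 x y u) * σ x w ≤ αθ) (hgσ' : ∀ w : κ, (∑ u, |A u w| * K3 x y u) * σ x w ≤ βθ) (z t : ι) :
    |(∫ ω : EuclideanSpace ℝ ι, exp (-U (ω + ψ)) ∂(multivariateGaussian 0 (A * Aᵀ)))⁻¹ * (∫ ω : EuclideanSpace ℝ ι, exp (-U (ω + ψ)) *
        ((U'' (ω + ψ) (EuclideanSpace.single x (1 : ℝ)) (EuclideanSpace.single y (1 : ℝ)) - ((∫ ω : EuclideanSpace ℝ ι, exp (-U (ω + ψ))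
            ∂(multivariateGaussian 0 (A * Aᵀ)))⁻¹ *
            (∫ ω : EuclideanSpace ℝ ι, exp (-U (ω + ψ)) * U'' (ω + ψ) (EuclideanSpace.single x (1 : ℝ)) (EuclideanSpace.single y (1 : ℝ))
                ∂(multivariateGaussian 0 (A * Aᵀ))))) *
          (U' (ω + ψ) (EuclideanSpace.single z (1 : ℝ)) - ((∫ ω : EuclideanSpace ℝ ι, exp (-U (ω + ψ)) ∂(multivariateGaussian 0 (A * Aᵀ)))⁻¹ *
            (∫ ω : EuclideanSpace ℝ ι, exp (-U (ω + ψ)) * U' (ω + ψ) (EuclideanSpace.single z (1 : ℝ)) ∂(multivariateGaussian 0 (A * Aᵀ))))) *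
          (U' (ω + ψ) (EuclideanSpace.single t (1 : ℝ)) - ((∫ ω : EuclideanSpace ℝ ι, exp (-U (ω + ψ)) ∂(multivariateGaussian 0 (A * Aᵀ)))⁻¹ *
            (∫ ω : EuclideanSpace ℝ ι, exp (-U (ω + ψ)) * U' (ω + ψ) (EuclideanSpace.single t (1 : ℝ)) ∂(multivariateGaussian 0 (A * Aᵀ))))))
        ∂(multivariateGaussian 0 (A * Aᵀ)))| ≤
      4 * Real.sqrt ((5 * ((κ₂ ^ 4 + κ₃ ^ 4) * γop ^ 2) / (1 - lam * γop) ^ 2) * (αθ * dθ * (βθ * dθ') / (1 - lamA))) / (ρ x z * ρ x t) := by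
  have hUc : Continuous U := continuous_iff_continuousAt.2 fun φ => (hUd φ).continuousAt
  have hU'c : Continuous U' := continuous_iff_continuousAt.2 fun φ => (hU'd φ).continuousAt
  have hU''c : Continuous U'' := continuous_iff_continuousAt.2 fun φ => (hU''d φ).continuousAt
  have h := whitened_mixed_third_cumulant_entry_raw hΓop Y hUd hU'd hU''d hU₃c hκ₀ hκ₁ ha hτ hδ hθ0 hθ1 hκθ hκθw hstab hU'b hU''b hU₃b hlam hUsec hρg
      hHk hHk0
    hK3 hK30 ψ hαr hαc hhr hlamA hlamA1 hγ hγ1 hD hDC hθnn hDr hdθ hDc hdθ' hσ0 hσθ hρ1 hρsymm hρmul hρσ haσ hβ haσ' x y hgσ hgσ' z t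
  rw [whitened_hess_mean_bridge hUc hU''c A ψ x y, whitened_mean_bridge hUc hU'c A ψ (EuclideanSpace.single z (1 : ℝ)),
    whitened_mean_bridge hUc hU'c A ψ (EuclideanSpace.single t (1 : ℝ)), whitened_mixed_triple_bridge hUc hU'c hU''c A ψ x y] at h
  exact h

/-! ## §3. Toy -/

/-- Toy (the common moment letter dominates each vertex letter): `5a ≤ 5(a+b)` for `b ≥ 0`. -/
example (a b : ℝ) (hb : 0 ≤ b) : 5 * a ≤ 5 * (a + b) := by linarith

end Summit.QuantumFields.BalabanUV.T4Continuum.NE7b.SupWhitenedMixedThirdCumulantEntry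

end
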